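import Mathlib
import HarnessLib

/-!
# Parity of a real pole with non-negative real boundary values (crux `BoundaryClosureR`,
# stmt-CriticalPhenomena-14004, line `polygon-parity-squeeze`, sub-goal `even_order_of_nonneg_real_pole`)

A pure one-variable analysis lemma used in the corner PARITY step of `stub_polygonIdentification`
(mechanism (A) of the line): if `(z - x₀)^m f(z) → c ≠ 0` as `z → x₀` in the punctured complex
neighbourhood of a real point `x₀`, and the values `f(x)` at real `x ≠ x₀` near `x₀` are
non-negative reals, then `m` is even and `c` is a positive real.

Proof: restrict the punctured limit to the real axis (the coercion `ℝ → ℂ` maps `𝓝[≠] x₀` into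
`𝓝[≠] (x₀ : ℂ)`), so `g(x) = (x - x₀)^m f(x) → c` along `𝓝[>] x₀` and along `𝓝[<] x₀`.  On the
right, `(x - x₀)^m > 0`, hence `g(x)` is a non-negative real and so is the limit `c`; `c ≠ 0` gives
`0 < c.re`.  On the left, if `m` were odd then `(x - x₀)^m < 0` and `re g(x) ≤ 0`, forcing
`c.re ≤ 0`, a contradiction ("a real `b/(w - x₀)` changes sign").

Only Mathlib is used.  Nothing about the parafermionic observable lives here.
-/

open Filter Topology

namespace Summit.CriticalPhenomena.SAWScalingLimit.Theorems.PolygonParitySqueeze.Analysis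

/-- The coercion `ℝ → ℂ` maps the punctured neighbourhood filter of `x₀ : ℝ` into the punctured
neighbourhood filter of `(x₀ : ℂ)` (continuity and injectivity of `Complex.ofReal`). [folklore] -/
theorem tendsto_ofReal_nhdsNE (x₀ : ℝ) :
    Tendsto (fun x : ℝ => (x : ℂ)) (𝓝[≠] x₀) (𝓝[≠] (x₀ : ℂ)) :=
  tendsto_nhdsWithin_of_tendsto_nhds_of_eventually_within _
    (Complex.continuous_ofReal.continuousAt.tendsto.mono_left nhdsWithin_le_nhds)
    (eventually_mem_nhdsWithin.mono fun _ hx => by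
      simpa only [Set.mem_compl_iff, Set.mem_singleton_iff, Complex.ofReal_inj] using hx)

/-- Real and imaginary parts of `(x - x₀)^m * w` for real `x, x₀`: the real power factors out.
[folklore] -/
theorem re_im_ofReal_sub_pow_mul (x x₀ : ℝ) (m : ℕ) (w : ℂ) :
    (((x : ℂ) - x₀) ^ m * w).re = (x - x₀) ^ m * w.re ∧
      (((x : ℂ) - x₀) ^ m * w).im = (x - x₀) ^ m * w.im := by
  rw [← Complex.ofReal_sub, ← Complex.ofReal_pow, Complex.re_ofReal_mul, Complex.im_ofReal_mul]
  exact ⟨rfl, rfl⟩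

/-- **Registered sub-goal `even_order_of_nonneg_real_pole` (corner parity).**  Let `f : ℂ → ℂ`,
`x₀ : ℝ`, `m : ℕ`, `c : ℂ` with `c ≠ 0` and `(z - x₀)^m f(z) → c` as `z → x₀`, `z ≠ x₀`.  If
`f(x)` is a non-negative real for all real `x ≠ x₀` close to `x₀`, then `m` is even, `0 < re c`
and `im c = 0`: restricting to `x > x₀` shows `c` is a non-negative (hence positive) real, and for
odd `m` restricting to `x < x₀` would give `re c ≤ 0`. [folklore] -/
theorem even_order_of_nonneg_real_pole : ∀ (f : ℂ → ℂ) (x₀ : ℝ) (m : ℕ) (c : ℂ), c ≠ 0 → Tendsto (fun z : ℂ => (z - x₀) ^ m * f z) (𝓝[≠] (x₀ : ℂ)) (𝓝 c) → (∀ᶠ x : ℝ in 𝓝[≠] x₀, 0 ≤ (f x).re ∧ (f x).im = 0) → Even m ∧ 0 < c.re ∧ c.im = 0 := by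
  intro f x₀ m c hc hT hB
  -- the real restriction `g(x) = (x - x₀)^m f(x)` tends to `c` along the real punctured filter
  have hgT : Tendsto (fun x : ℝ => ((x : ℂ) - x₀) ^ m * f x) (𝓝[≠] x₀) (𝓝 c) :=
    hT.comp (tendsto_ofReal_nhdsNE x₀)
  have hgre : Tendsto (fun x : ℝ => (((x : ℂ) - x₀) ^ m * f x).re) (𝓝[≠] x₀) (𝓝 c.re) :=
    (Complex.continuous_re.tendsto c).comp hgT
  have hgim : Tendsto (fun x : ℝ => (((x : ℂ) - x₀) ^ m * f x).im) (𝓝[≠] x₀) (𝓝 c.im) :=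
    (Complex.continuous_im.tendsto c).comp hgT
  -- imaginary part: `im g(x) = 0` eventually on the right, so `im c = 0`
  have hcim : c.im = 0 := by
    have h0 : ∀ᶠ x : ℝ in 𝓝[>] x₀, (((x : ℂ) - x₀) ^ m * f x).im = (0 : ℝ) := by
      filter_upwards [hB.filter_mono (nhdsGT_le_nhdsNE x₀)] with x hx
      rw [(re_im_ofReal_sub_pow_mul x x₀ m (f x)).2, hx.2, mul_zero]
    exact tendsto_nhds_unique ((hgim.mono_left (nhdsGT_le_nhdsNE x₀)).congr' h0)
      tendsto_const_nhds
  -- real part on the right: `re g(x) ≥ 0` eventually, so `0 ≤ re c`, and `c ≠ 0` gives `0 < re c`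
  have hcre : 0 ≤ c.re := by
    refine ge_of_tendsto (hgre.mono_left (nhdsGT_le_nhdsNE x₀)) ?_
    filter_upwards [hB.filter_mono (nhdsGT_le_nhdsNE x₀), self_mem_nhdsWithin] with x hx hx'
    rw [(re_im_ofReal_sub_pow_mul x x₀ m (f x)).1]
    exact mul_nonneg (pow_nonneg (sub_nonneg.2 (le_of_lt hx')) m) hx.1
  have hcre' : 0 < c.re :=
    hcre.lt_of_ne fun h => hc (Complex.ext (by simpa using h.symm) (by simpa using hcim))
  -- parity on the left: for odd `m`, `re g(x) ≤ 0` eventually, so `re c ≤ 0`, absurd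
  refine ⟨(Nat.even_or_odd m).resolve_right fun hodd => ?_, hcre', hcim⟩
  refine absurd (le_of_tendsto (hgre.mono_left (nhdsLT_le_nhdsNE x₀)) ?_) (not_le.2 hcre')
  filter_upwards [hB.filter_mono (nhdsLT_le_nhdsNE x₀), self_mem_nhdsWithin] with x hx hx'
  rw [(re_im_ofReal_sub_pow_mul x x₀ m (f x)).1]
  exact mul_nonpos_of_nonpos_of_nonneg (hodd.pow_neg (sub_neg.2 hx')).le hx.1

end Summit.CriticalPhenomena.SAWScalingLimit.Theorems.PolygonParitySqueeze.Analysis
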